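import Mathlib
import HarnessLib
import Summits.HubbardSuperconductivity.HubbardSuperconductivity.Theorems.KLProgrammeC4aJacobianFrameJetsFour
import Summits.HubbardSuperconductivity.HubbardSuperconductivity.Theorems.KLProgrammePerturbedFermiCurveWindowJetsJacobian

/-!
# Route `KLProgramme` — crux C4a, named input (i) «Jacobian jets»: the CERTIFIED table at orders `≤ 2` plus the frame perturbation,
# assembled into the `hJjet` hypothesis of the tube tadpole-jet theorem (`…C4aTubeTadpole`) — `klJacGCert T Dt A A₃ A₄ A₅ i`

Cell `gate-hubbard-kl`, lane hubbard-kl-c4a-1 (g3); helper for stub (C) `stub_twoLeg_curvature` of the engine-flow child `KLRegimeEngineV17F2`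
(stmt-HubbardSuperconductivity-20437); plan g17 (R47r) «replace the generic `klJacG` table (which overshoots the natural chart-Jacobian jets by
`10²–10³` at orders 1–2) by a window-specific CERTIFIED bundle before any `k ≤ 2` numeral is read»; memo HOME/hubbard-kl-c4a-1/C4A-PLAN.md §15.3
(alternative (M-alt): certify `i ≤ 2`, keep the generic graded table at `i = 3, 4`); division of labour KL STATUS l.3342/l.3344/l.3404:
k3c3-p3 g7 supplied the vocabulary of record `PerturbedFermiCurve.FreeBandPolarJets a b T` (tables `klwjTableA/B`, hypotheses `KlwjCertA/B`,
…WindowJetsDefs) and the frame perturbation `frame_polarJac_le_of_polarJets` (…WindowJetsJacobian: `|J_K^{(i)}| ≤ T.G_i + Γ_i`, `i ≤ 2`, `Γ_i` explicit,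
vanishing with the frame); THIS file is the c4a-1 half — the assembly in the lane's currency (ONE `C²` size `A` for the frame's orders `≤ 2`, as in
`frame_sizes_of_frameOK(_explicit)` and every `…C4a*` file, plus `A₃, A₄, A₅`):

* §1 `jacW1 Dt A`, `jacW2 T Dt A` — the radius widths `W₁, W₂` of `frame_polar_tower_of_window` at `A₀ = A₁ = A₂ := A` (closed forms, taken with equality);
  `jacPert0 T Dt A`, `jacPert1 T Dt A`, `jacPert2 T Dt A A₃` — k3c3-p3's `Γ₀, Γ₁, Γ₂` at those widths (every term carries a factor `A`, the order-3 size `A₃`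
  entering `Γ₂` only through the band's third-derivative size `4 + 8A₃`; so `Γ_i → 0` as `A → 0` at fixed `A₃`);
* §2 **`klJacGCert T Dt A A₃ A₄ A₅ i`** — THE table: `T.G_i + jacPert_i` for `i ≤ 2`, the generic graded `klJacGTable4 Dt A A₃ A₄ A₅ i` (…C4aJacobianFrameJetsFour)
  for `i ≥ 3` (orders 3, 4 sit in the `|U|`-suppressed slot / carry `4ⁿ`-gains, memo §12.3′, so generic constants are harmless there);
* §3 **`norm_iteratedDeriv_levelChartJac_le_cert`** — under `FreeBandPolarJets a b T` on the band window of `B : BandBounds a b`, for a frame with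
  `‖Dʲ frameShift K‖ ≤ A` (`j ≤ 2`), `2A < B.Dtmin`, `‖D³‖ ≤ A₃`, `‖D⁴‖ ≤ A₄`, `‖D⁵‖ ≤ A₅` and a level `μ + ρ` with margins `A` strictly inside `(a, b)`:
  `∀ i ≤ 4, ∀ s, ‖iteratedDeriv i (fun s => levelChartJac μ K (ρ, s)) s‖ ≤ klJacGCert T B.Dtmin A A₃ A₄ A₅ i` — EXACTLY the `hJjet` hypothesis of
  `norm_iteratedDeriv_tubeTadpole_le` (`N = 4`), with `G i ↦ klJacGCert T B.Dtmin A A₃ A₄ A₅ i`; `…_le_cert_two` = the `N = 2` form needing only `A₃`.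
  Instances: `T = klwjTableB` on `[a, b] = [-1.1, -0.1]` (the lineage's `bandBounds` range; `G = (4.538, 18.62, 469.9)`, hypothesis `KlwjCertB`) or
  `T = klwjTableA` on `[-87/80, -9/80]` (`G = (4.261, 16.43, 392.8)`, `KlwjCertA`) with a `BandBounds` of that window.

Pure bookkeeping on landed theorems; the certified numbers enter only through the HYPOTHESIS `FreeBandPolarJets a b T` (KLCert pattern); nothing is
asserted about the Hubbard model.  References: BGM 2006 §2.4 Lemma 2.1 (2.40) [cite: BenfattoGiulianiMastropietro2006].
-/

noncomputable section

namespace Summit.HubbardSuperconductivity.HubbardSuperconductivity.Theorems.C4a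

set_option linter.dupNamespace false -- summit = problem name (single-conjunct summit), D-0017
set_option maxSynthPendingDepth 4 -- nested operator-norm instances (up to fifth Fréchet derivatives of the frame)

open Real Set
open Literature.MathematicalPhysics.QuantumLattice Literature.MathematicalPhysics.QuantumLattice.BandSectorCounting
open Summit.HubbardSuperconductivity.HubbardSuperconductivity.Theorems.DispersionFlow
open Summit.HubbardSuperconductivity.HubbardSuperconductivity.Theorems.KLRegimeSplit
open Summit.HubbardSuperconductivity.HubbardSuperconductivity.Theorems.PerturbedFermiCurve

/-! ## §1 The widths and the perturbation terms at a single `C²` size `A` -/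

/-- `W₁(Dt, A)` — the order-1 radius width of `frame_polar_tower_of_window` at `A₀ = A₁ := A` (closed form, `ρ₀ = Dt − 2A`, `U₀ = π√2`). -/
def jacW1 (Dt A : ℝ) : ℝ :=
  ((4 + 2 * A) * (A / (Dt - 2 * A)) + (π * Real.sqrt 2 + (4 + 2 * A) * (π * Real.sqrt 2) / (Dt - 2 * A)) * ((4 + 0) * (A / (Dt - 2 * A)) + 2 * A)) /
  (Dt - 2 * A)

/-- `W₂(T, Dt, A)` — the order-2 radius width of `frame_polar_tower_of_window` at `A₀ = A₁ = A₂ := A`, `W₁ := jacW1 Dt A`, free sizes `T.R1`, `T.R2`. -/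
def jacW2 (T : PolarJetTable) (Dt A : ℝ) : ℝ :=
  A / (Dt - 2 * A) + (((4 + 0) * (A / (Dt - 2 * A)) + 4 * A) * ((T.R1 + jacW1 Dt A) + π * Real.sqrt 2) ^ 2 + 2 * (4 + 0) * ((T.R1 + jacW1 Dt A) + π *
  Real.sqrt 2) * (jacW1 Dt A + A / (Dt - 2 * A)) + ((4 + 0) * (A / (Dt - 2 * A)) + 2 * A) * (2 * (T.R1 + jacW1 Dt A) + π * Real.sqrt 2) + (4 + 2 * A)
  * (A / (Dt - 2 * A) + 2 * jacW1 Dt A) + (T.R2 + π * Real.sqrt 2) * ((4 + 0) * (A / (Dt - 2 * A)) + 2 * A)) / (Dt - 2 * A)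

/-- `Γ₀(T, Dt, A) = W₀/ρ₀ + U₀(4W₀ + 2A)/ρ₀²` with `W₀ = A/ρ₀`, `U₀ = T.umax` — the order-0 Jacobian perturbation. -/
def jacPert0 (T : PolarJetTable) (Dt A : ℝ) : ℝ :=
  (A / (Dt - 2 * A) / (Dt - 2 * A) + T.umax * (4 * (A / (Dt - 2 * A)) + 2 * A) / (Dt - 2 * A) ^ 2)

/-- `Γ₁(T, Dt, A)` — the order-1 Jacobian perturbation (k3c3-p3's closed form at `A₀ = A₁ = A₂ := A`, `W₁ := jacW1 Dt A`). -/
def jacPert1 (T : PolarJetTable) (Dt A : ℝ) : ℝ :=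
  (jacW1 Dt A / (Dt - 2 * A) + (T.R1 + jacW1 Dt A) * (4 * (A / (Dt - 2 * A)) + 2 * A) / (Dt - 2 * A) ^ 2 + (((A / (Dt - 2 * A)) * ((4 + 4 * A) *
  ((T.R1 + jacW1 Dt A) + (T.umax + A / (Dt - 2 * A))) + (4 + 2 * A)) + (T.umax + A / (Dt - 2 * A)) * ((4 * (A / (Dt - 2 * A)) + 4 * A) * ((T.R1 +
  jacW1 Dt A) + (T.umax + A / (Dt - 2 * A))) + (4 + 4 * A) * (jacW1 Dt A + (A / (Dt - 2 * A))) + (4 * (A / (Dt - 2 * A)) + 2 * A))) / (Dt - 2 * A) ^ 2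
  + 2 * ((T.umax + A / (Dt - 2 * A)) * ((4 + 4 * A) * ((T.R1 + jacW1 Dt A) + (T.umax + A / (Dt - 2 * A))) + (4 + 2 * A))) * (4 * (A / (Dt - 2 * A)) +
  2 * A) / (Dt - 2 * A) ^ 3))

/-- `Γ₂(T, Dt, A, A₃)` — the order-2 Jacobian perturbation (k3c3-p3's closed form at `A₀ = A₁ = A₂ := A`, `W₁ := jacW1 Dt A`, `W₂ := jacW2 T Dt A`). -/
def jacPert2 (T : PolarJetTable) (Dt A A₃ : ℝ) : ℝ :=
  ((jacW2 T Dt A / (Dt - 2 * A) + (T.R2 + jacW2 T Dt A) * (4 * (A / (Dt - 2 * A)) + 2 * A) / (Dt - 2 * A) ^ 2) + (((A / (Dt - 2 * A)) * ((4 + 8 * A₃)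
  * ((T.R1 + jacW1 Dt A) + (T.umax + A / (Dt - 2 * A))) ^ 2 + (4 + 4 * A) * ((T.R2 + jacW2 T Dt A) + 2 * (T.R1 + jacW1 Dt A) + (T.umax + A / (Dt - 2 *
  A))) + 2 * ((4 + 4 * A) * ((T.R1 + jacW1 Dt A) + (T.umax + A / (Dt - 2 * A)))) + (4 + 2 * A)) + (T.umax + A / (Dt - 2 * A)) * ((4 * (A / (Dt - 2 *
  A)) + 8 * A₃) * ((T.R1 + jacW1 Dt A) + (T.umax + A / (Dt - 2 * A))) ^ 2 + 2 * (4 + 8 * A₃) * ((T.R1 + jacW1 Dt A) + (T.umax + A / (Dt - 2 * A))) *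
  (jacW1 Dt A + (A / (Dt - 2 * A))) + (4 * (A / (Dt - 2 * A)) + 4 * A) * ((T.R2 + jacW2 T Dt A) + (T.umax + A / (Dt - 2 * A)) + 2 * (T.R1 + jacW1 Dt
  A)) + (4 + 4 * A) * (jacW2 T Dt A + 2 * jacW1 Dt A + (A / (Dt - 2 * A))) + 2 * ((4 * (A / (Dt - 2 * A)) + 4 * A) * ((T.R1 + jacW1 Dt A) + (T.umax +
  A / (Dt - 2 * A))) + (4 + 4 * A) * (jacW1 Dt A + (A / (Dt - 2 * A)))) + (4 * (A / (Dt - 2 * A)) + 2 * A))) / (Dt - 2 * A) ^ 2 + 2 * ((T.umax + A /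
  (Dt - 2 * A)) * ((4 + 8 * A₃) * ((T.R1 + jacW1 Dt A) + (T.umax + A / (Dt - 2 * A))) ^ 2 + (4 + 4 * A) * ((T.R2 + jacW2 T Dt A) + 2 * (T.R1 + jacW1
  Dt A) + (T.umax + A / (Dt - 2 * A))) + 2 * ((4 + 4 * A) * ((T.R1 + jacW1 Dt A) + (T.umax + A / (Dt - 2 * A)))) + (4 + 2 * A))) * (4 * (A / (Dt - 2 *
  A)) + 2 * A) / (Dt - 2 * A) ^ 3) + 2 * ((jacW1 Dt A * ((4 + 4 * A) * ((T.R1 + jacW1 Dt A) + (T.umax + A / (Dt - 2 * A))) + (4 + 2 * A)) + (T.R1 +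
  jacW1 Dt A) * ((4 * (A / (Dt - 2 * A)) + 4 * A) * ((T.R1 + jacW1 Dt A) + (T.umax + A / (Dt - 2 * A))) + (4 + 4 * A) * (jacW1 Dt A + (A / (Dt - 2 *
  A))) + (4 * (A / (Dt - 2 * A)) + 2 * A))) / (Dt - 2 * A) ^ 2 + 2 * ((T.R1 + jacW1 Dt A) * ((4 + 4 * A) * ((T.R1 + jacW1 Dt A) + (T.umax + A / (Dt -
  2 * A))) + (4 + 2 * A))) * (4 * (A / (Dt - 2 * A)) + 2 * A) / (Dt - 2 * A) ^ 3) + 2 * (((A / (Dt - 2 * A)) * ((4 + 4 * A) * ((T.R1 + jacW1 Dt A) +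
  (T.umax + A / (Dt - 2 * A))) + (4 + 2 * A)) ^ 2 + 2 * ((T.umax + A / (Dt - 2 * A)) * ((4 + 4 * A) * ((T.R1 + jacW1 Dt A) + (T.umax + A / (Dt - 2 *
  A))) + (4 + 2 * A))) * ((4 * (A / (Dt - 2 * A)) + 4 * A) * ((T.R1 + jacW1 Dt A) + (T.umax + A / (Dt - 2 * A))) + (4 + 4 * A) * (jacW1 Dt A + (A /
  (Dt - 2 * A))) + (4 * (A / (Dt - 2 * A)) + 2 * A))) / (Dt - 2 * A) ^ 3 + 3 * ((T.umax + A / (Dt - 2 * A)) * ((4 + 4 * A) * ((T.R1 + jacW1 Dt A) +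
  (T.umax + A / (Dt - 2 * A))) + (4 + 2 * A)) ^ 2) * (4 * (A / (Dt - 2 * A)) + 2 * A) / (Dt - 2 * A) ^ 4))

/-! ## §2 The table -/

/-- **The certified-plus-perturbation Jacobian-jet table**: `T.G_i + Γ_i` at orders `i ≤ 2` (certified free-band column of the polar-jet table `T`
plus the frame perturbation), the generic graded `klJacGTable4` at orders `≥ 3`. -/
def klJacGCert (T : PolarJetTable) (Dt A A₃ A₄ A₅ : ℝ) (i : ℕ) : ℝ :=
  if i = 0 then T.G0 + jacPert0 T Dt A
  else if i = 1 then T.G1 + jacPert1 T Dt A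
  else if i = 2 then T.G2 + jacPert2 T Dt A A₃
  else klJacGTable4 Dt A A₃ A₄ A₅ i

/-- Row `0`. -/
@[simp] theorem klJacGCert_zero (T : PolarJetTable) (Dt A A₃ A₄ A₅ : ℝ) : klJacGCert T Dt A A₃ A₄ A₅ 0 = T.G0 + jacPert0 T Dt A := by
  simp [klJacGCert]

/-- Row `1`. -/
@[simp] theorem klJacGCert_one (T : PolarJetTable) (Dt A A₃ A₄ A₅ : ℝ) : klJacGCert T Dt A A₃ A₄ A₅ 1 = T.G1 + jacPert1 T Dt A := by
  simp [klJacGCert]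

/-- Row `2`. -/
@[simp] theorem klJacGCert_two (T : PolarJetTable) (Dt A A₃ A₄ A₅ : ℝ) : klJacGCert T Dt A A₃ A₄ A₅ 2 = T.G2 + jacPert2 T Dt A A₃ := by
  simp [klJacGCert]

/-- Rows `≥ 3` are the generic graded table. -/
theorem klJacGCert_of_three_le (T : PolarJetTable) (Dt A A₃ A₄ A₅ : ℝ) {i : ℕ} (hi : 3 ≤ i) :
    klJacGCert T Dt A A₃ A₄ A₅ i = klJacGTable4 Dt A A₃ A₄ A₅ i := by
  have h0 : i ≠ 0 := by omega
  have h1 : i ≠ 1 := by omega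
  have h2 : i ≠ 2 := by omega
  simp [klJacGCert, h0, h1, h2]

/-- The rows `≤ 2` do not read `A₄, A₅`. -/
theorem klJacGCert_of_le_two (T : PolarJetTable) (Dt A A₃ A₄ A₅ A₄' A₅' : ℝ) {i : ℕ} (hi : i ≤ 2) :
    klJacGCert T Dt A A₃ A₄ A₅ i = klJacGCert T Dt A A₃ A₄' A₅' i := by
  interval_cases i <;> simp [klJacGCert]

/-! ## §3 The assembly -/

section Frame

variable {a b : ℝ} (B : BandBounds a b) {K : TrigPolyC4v} {A : ℝ}
  (hA : ∀ p : Momentum, ∀ j ≤ 2, ‖iteratedFDeriv ℝ j (frameShift K) p‖ ≤ A) (hADt : 2 * A < B.Dtmin)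
  {μ ρ : ℝ} (hlo : a < μ + ρ - A) (hhi : μ + ρ + A < b)
include B hA hADt hlo hhi

/-- **Orders `0, 1, 2` at the frame from a polar-jet table**: under `FreeBandPolarJets a b T`, at the level `μ + ρ` and every angle,
`|J_K| ≤ T.G0 + Γ₀`, `|J_K′| ≤ T.G1 + Γ₁`, `|J_K″| ≤ T.G2 + Γ₂` for the chart weight `J_K = levelChartJac μ K (ρ, ·)` — k3c3-p3's
`frame_polarJac_le_of_polarJets` read through `levelChartJac_curve_eq_polarJac` at `A₀ = A₁ = A₂ := A`, `W₁ := jacW1`, `W₂ := jacW2`.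
[cite: BenfattoGiulianiMastropietro2006, §2.4 Lemma 2.1 (2.40)] -/
theorem abs_levelChartJac_jets_le_cert {T : PolarJetTable} (hT : FreeBandPolarJets a b T) {A₃ : ℝ}
    (hA₃ : ∀ p : Momentum, ‖iteratedFDeriv ℝ 3 (frameShift K) p‖ ≤ A₃) (ϑ : ℝ) :
    |levelChartJac μ K (ρ, ϑ)| ≤ T.G0 + jacPert0 T B.Dtmin A ∧
    |deriv (fun s : ℝ => levelChartJac μ K (ρ, s)) ϑ| ≤ T.G1 + jacPert1 T B.Dtmin A ∧
    |deriv (deriv (fun s : ℝ => levelChartJac μ K (ρ, s))) ϑ| ≤ T.G2 + jacPert2 T B.Dtmin A A₃ := by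
  have hA₀ : ∀ p : Momentum, ‖iteratedFDeriv ℝ 0 (frameShift K) p‖ ≤ A := fun p => hA p 0 (by norm_num)
  have hA₁ : ∀ p : Momentum, ‖iteratedFDeriv ℝ 1 (frameShift K) p‖ ≤ A := fun p => hA p 1 (by norm_num)
  have hA₂ : ∀ p : Momentum, ‖iteratedFDeriv ℝ 2 (frameShift K) p‖ ≤ A := fun p => hA p 2 le_rfl
  obtain ⟨j0, j1, j2⟩ := frame_polarJac_le_of_polarJets B hA₀ hA₁ hA₂ hA₃ hADt (ν := μ + ρ) hlo.le hhi.le hT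
    (W₁ := jacW1 B.Dtmin A) (W₂ := jacW2 T B.Dtmin A) (by unfold jacW1; exact le_rfl) (by unfold jacW2; exact le_rfl) ϑ
  rw [levelChartJac_curve_eq_polarJac B hA hADt hlo hhi, levelChartJac_eq_polarJac B hA hADt hlo hhi ϑ]
  exact ⟨j0, j1, j2⟩

/-- **`hJjet` at `N = 2` from the certificate**: `∀ i ≤ 2, ∀ s, ‖iteratedDeriv i (levelChartJac μ K (ρ, ·)) s‖ ≤ klJacGCert T B.Dtmin A A₃ A₄ A₅ i`
(only `A₃` is read; `A₄, A₅` arbitrary). -/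
theorem norm_iteratedDeriv_levelChartJac_le_cert_two {T : PolarJetTable} (hT : FreeBandPolarJets a b T) {A₃ : ℝ}
    (hA₃ : ∀ p : Momentum, ‖iteratedFDeriv ℝ 3 (frameShift K) p‖ ≤ A₃) (A₄ A₅ : ℝ) {i : ℕ} (hi : i ≤ 2) (s : ℝ) :
    ‖iteratedDeriv i (fun s : ℝ => levelChartJac μ K (ρ, s)) s‖ ≤ klJacGCert T B.Dtmin A A₃ A₄ A₅ i := by
  obtain ⟨j0, j1, j2⟩ := abs_levelChartJac_jets_le_cert B hA hADt hlo hhi hT hA₃ s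
  rw [Real.norm_eq_abs]
  interval_cases i
  · simpa using j0
  · simpa using j1
  · rw [klJacGCert_two, iteratedDeriv_succ, iteratedDeriv_one]
    exact j2

/-- **`hJjet` at `N = 4` from the certificate (THE ASSEMBLY)**: for every level `ρ` with `[μ + ρ − A, μ + ρ + A] ⊂ (a, b)` strictly,
`∀ i ≤ 4, ∀ s, ‖iteratedDeriv i (fun s => levelChartJac μ K (ρ, s)) s‖ ≤ klJacGCert T B.Dtmin A A₃ A₄ A₅ i` — orders `≤ 2` certified-plus-perturbation,
orders `3, 4` the generic graded table `klJacGTable4` (`norm_iteratedDeriv_levelChartJac_le_four`).  This is the `hJjet` hypothesis of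
`norm_iteratedDeriv_tubeTadpole_le` with `G := klJacGCert T B.Dtmin A A₃ A₄ A₅`. [cite: BenfattoGiulianiMastropietro2006, §2.4 Lemma 2.1 (2.40)] -/
theorem norm_iteratedDeriv_levelChartJac_le_cert {T : PolarJetTable} (hT : FreeBandPolarJets a b T) {A₃ A₄ A₅ : ℝ}
    (hA₃ : ∀ p : Momentum, ‖iteratedFDeriv ℝ 3 (frameShift K) p‖ ≤ A₃)
    (hA₄ : ∀ p : Momentum, ‖iteratedFDeriv ℝ 4 (frameShift K) p‖ ≤ A₄)
    (hA₅ : ∀ p : Momentum, ‖iteratedFDeriv ℝ 5 (frameShift K) p‖ ≤ A₅) {i : ℕ} (hi : i ≤ 4) (s : ℝ) :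
    ‖iteratedDeriv i (fun s : ℝ => levelChartJac μ K (ρ, s)) s‖ ≤ klJacGCert T B.Dtmin A A₃ A₄ A₅ i := by
  by_cases h2 : i ≤ 2
  · exact norm_iteratedDeriv_levelChartJac_le_cert_two B hA hADt hlo hhi hT hA₃ A₄ A₅ h2 s
  · rw [klJacGCert_of_three_le T B.Dtmin A A₃ A₄ A₅ (by omega)]
    exact norm_iteratedDeriv_levelChartJac_le_four B hA hADt hlo hhi hA₃ hA₄ hA₅ hi s

omit hlo hhi in
/-- **The tube form** (the literal `hJjet` binder of `norm_iteratedDeriv_tubeTadpole_le` at `N = 4`): if the whole tube of half-width `r` around the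
level `μ` sits with margins `A` strictly inside `(a, b)`, then
`∀ ρ, |ρ| < r → ∀ i ≤ 4, ∀ s, ‖iteratedDeriv i (fun s => levelChartJac μ K (ρ, s)) s‖ ≤ klJacGCert T B.Dtmin A A₃ A₄ A₅ i`. -/
theorem hJjet_cert {T : PolarJetTable} (hT : FreeBandPolarJets a b T) {A₃ A₄ A₅ : ℝ}
    (hA₃ : ∀ p : Momentum, ‖iteratedFDeriv ℝ 3 (frameShift K) p‖ ≤ A₃)
    (hA₄ : ∀ p : Momentum, ‖iteratedFDeriv ℝ 4 (frameShift K) p‖ ≤ A₄)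
    (hA₅ : ∀ p : Momentum, ‖iteratedFDeriv ℝ 5 (frameShift K) p‖ ≤ A₅) {r : ℝ} (hlo' : a < μ - r - A) (hhi' : μ + r + A < b) :
    ∀ ρ' : ℝ, |ρ'| < r → ∀ i ≤ 4, ∀ s : ℝ,
      ‖iteratedDeriv i (fun s : ℝ => levelChartJac μ K (ρ', s)) s‖ ≤ klJacGCert T B.Dtmin A A₃ A₄ A₅ i := by
  intro ρ' hρ' i hi s
  have h1 : a < μ + ρ' - A := by linarith [(abs_lt.1 hρ').1]
  have h2 : μ + ρ' + A < b := by linarith [(abs_lt.1 hρ').2]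
  exact norm_iteratedDeriv_levelChartJac_le_cert B hA hADt h1 h2 hT hA₃ hA₄ hA₅ hi s

end Frame

end Summit.HubbardSuperconductivity.HubbardSuperconductivity.Theorems.C4a

end
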